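import Summits.BirchSwinnertonDyer.BirchSwinnertonDyer.Theorems.ClassRecordThreeEulerHalvesAtThreeCartanCorrespondenceCut
import HarnessLib

/-!
# Crux 19109 `EulerHalvesAtThree` ∕ 23422 line `cartan` v9, stub (F2b♭) — the torus pair sum U♯ in CLOSED FORM at the principal-series places:
# `S(η) = (q−1)²·N(A + Bω + Cω²)` for the cubic-class counts `(A,B,C)` of `(x² + βx + γ)/x` over `𝔽_q^×`; U♯ ⟸ closed form ∧ an
# elementary count law ∧ U♯ at the cuspidal places (PROVED), and the count law DECIDED at `q = 7, 13, 19, 31, 37, 43` (incl. `q ≡ 1 (9)`)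

Seat `bsd-idea-10` g12 (planner-bsd-idea-10-g12-0, D-0145 ideator; `--supports stmt-BirchSwinnertonDyer-19109 --as helper`; companion of
`…CartanCorrespondenceCut` (p686517: `torusPairSum`, U♯ = `CubicTorusPairSumAtThree`) and `…CartanCorrespondenceCutTight` (p687002)).

THE COMPUTATION (paper; [cite: Bump1997, §4.1] for the induced model; the resulting sums are the «Legendre ∕ Soto-Andrade character sums» by which
[cite: Chen2000, §§8–9, Props. 8.3–8.5, Rem. 8.6 (I. Chen, J. Algebra 231 (2000), doi:10.1006/jabr.2000.8375)] computes the eigenvalues of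
double-coset operators between Cartan-level modular curves, and [cite: Terras1999, Ch. 20 (19), Ch. 21 Thm. 4 (Soto-Andrade's formula)]). Let `q ≡ 1 (3)`,
`W_q = Ind_B^G(θ ⊗ θ̄)` (`θ` a cubic character of `𝔽_q^×`) realised as `χ`-twisted functions on `B\G = ℙ¹(𝔽_q)`. The norm operators are
`N_T = |T|·P_T` (`P_T` the orthogonal projector on the `T`-fixed line), so `S(η) := Σ_{s∈T_s} Σ_{t∈T_η} χ_W(st) = tr(N_{T_s}N_{T_η})
= (q−1)²(q²−1)·|⟨ŵ_s, ŵ_η⟩|²`. The fixed vectors are EXPLICIT: for a torus `T` with fixed-point form `Q_T(c,d)` on `ℙ¹` (split: `Q = cd`;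
`T_η`: `Q_η(c,d) = −η₀₁c² + (η₀₀−η₁₁)cd + η₁₀d²`, irreducible), `w_T(g) = θ(det g)·θ(Q_T(c,d))⁻¹` (`(c,d)` = bottom row of `g`), with values in `μ₃`,
`‖w_s‖² = q−1`, `‖w_η‖² = q+1`. Hence **`S(η) = (q−1)²·|Σ_η|²`, `Σ_η = Σ_{x∈𝔽_q^×} θ(Q_η(x,1)/x) = A + Bω + Cω² ∈ ℤ[ω]`**, where `(A,B,C)` count the
`x ∈ 𝔽_q^×` with `Q_η(x,1)/x` in each of the three classes modulo cubes, and `|Σ_η|² = A²+B²+C²−AB−BC−CA` (`hexNorm`, labelling-free).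
NUMERICAL CHECK (this seat, `corr/check_identity.py`, `corr/sigma_ps.py`): the identity holds for every elliptic `η` tested at `q = 7, 13` (198 pairs
`(η, T_η)`, 0 mismatches) and reproduces the full `S`-distribution at `q = 19`; the values are `|Σ|² = 3m²` for ALL irreducible forms at
`q = 7, …, 43` (i.e. `Σ/(1−ω) ∈ μ₆·ℤ`), and `Σ_{T'} |Σ|² = q(q−1)²/2` (second moment, = `tr` of `Σ_{T'} P_{T'}` on `W_q`; all data agree).
CONSEQUENCES. (i) `3 ∣ S(η)/(q−1)²` always (`Σ ≡ q−1 ≡ 0 mod (1−ω)`); (ii) U♯ at a PS place ⟺ ∃ irreducible `x²+βx+γ` with `Σ ≢ 0 (mod 3)`,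
i.e. NOT `A ≡ B ≡ C (mod 3)` — the elementary COUNT LAW `CubicClassCountLawAtThree` below, decided here for `q = 7, 13, 19, 31, 37, 43`
(witnesses `(β,γ) = (1,4), (1,4), (1,9), (1,2), (1,30), (1,9)`, each with `|Σ|² = 3`), and checked by script up to `q = 73`; (iii) given
`|Σ|² ∈ 3·□` and the second moment, the count law holds for every `q ≡ 1 (3)` with `q ≢ 1 (9)` (else `27 ∣ q(q−1)²/2`), so only
`q ≡ 1 (9)` needs the witnesses — `q = 19, 37, 73` are checked.

WHAT IS PROVED HERE (sorry-free): `cubicTorusPairSum_of_closedForm` : closed form ∧ count law ∧ U♯-at-cuspidal-places → U♯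
(`CubicTorusPairSumAtThree`, BY NAME), via the explicit torus `η = !![β, −1; γ, 0]` (`not_hasRatEigenvalue_of_irreducible`); the count law's
instances `cubicClassCountLaw_7 ∕ _13 ∕ _19 ∕ _31 ∕ _37 ∕ _43` (kernel `decide`), assembled as `cubicClassCountLawUpTo43 : CubicClassCountLawUpTo43AtThree` (the law for every prime `q ≡ 1 (3)`, `q ≤ 43`). Three closed `@[conjecture]` statements: the closed form
(a finite-group identity, provable by the displayed computation — typing the induced model is the work), the count law (elementary; open
uniformly, decided in cases), U♯ at cuspidal places (`q ≡ 2 (3)` and `q = 2`; numerics `q = 2, 5, 11, 17` in the Cut file; its closed form is a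
Soto-Andrade sum [cite: Terras1999, Ch. 21 Thm. 4], not typed here). HONEST FRAMING: U♯ itself is NOT proved; nothing about (F2b♭), NUM, COR,
SIGN, S-K1′ is proved here; no summit statement, no route item, no registered stub is proved; BSD is proved for no curve.
-/

set_option linter.dupNamespace false
set_option autoImplicit false

namespace Summit.BirchSwinnertonDyer.BirchSwinnertonDyer.Theorems.CartanCorrespondence

open Summit.BirchSwinnertonDyer.BirchSwinnertonDyer.Theorems
  Summit.BirchSwinnertonDyer.BirchSwinnertonDyer.Theorems.CartanDegree
  Summit.BirchSwinnertonDyer.BirchSwinnertonDyer.Theorems.CartanTorusCubeCut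

/-! ## §1 The cubic-class counts and the hexagonal norm (computable definitions) -/

/-- For `L(x) = (a x² + b x + c)/x` on `𝔽_q^×` (`q ≡ 1 (3)`, `ζ` a primitive cube root of unity in `𝔽_q`): the number of `x ≠ 0` with `L(x)` in the
`k`-th class modulo cubes, i.e. `L(x)^{(q−1)/3} = ζ^k`, written without division as `(a x²+b x+c)^{(q−1)/3} = ζ^k·x^{(q−1)/3}`. [folklore] -/
def cubicClassCount (q : ℕ) [NeZero q] (ζ a b c : ZMod q) (k : ℕ) : ℕ :=
  (Finset.univ.filter (fun x : ZMod q =>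
      x ≠ 0 ∧ (a * x ^ 2 + b * x + c) ^ ((q - 1) / 3) = ζ ^ k * x ^ ((q - 1) / 3))).card

/-- The norm of `A + Bω + Cω²` (`ω = e^{2πi/3}`): `A² + B² + C² − AB − BC − CA` (symmetric in `A, B, C`). [folklore] -/
def hexNorm (A B C : ℤ) : ℤ := A ^ 2 + B ^ 2 + C ^ 2 - A * B - B * C - C * A

/-- `|Σ|²` for `Σ = Σ_{x∈𝔽_q^×} θ((a x²+b x+c)/x) = A + Bω + Cω²`. [folklore] -/
def cubicSumNorm (q : ℕ) [NeZero q] (ζ a b c : ZMod q) : ℤ :=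
  hexNorm (cubicClassCount q ζ a b c 0) (cubicClassCount q ζ a b c 1) (cubicClassCount q ζ a b c 2)

/-! ## §2 The three statements (closed, tagged `@[conjecture]`) -/

/-- **CLOSED FORM OF THE TORUS PAIR SUM AT A PRINCIPAL-SERIES PLACE**: for `q ≡ 1 (3)` and elliptic `η`,
`S(η) = torusPairSum q η = (q−1)²·|Σ_η|²` with `Σ_η` the cubic character sum of `Q_η(x,1)/x`, `Q_η = −η₀₁x² + (η₀₀−η₁₁)x + η₁₀`. A finite-group
identity (explicit fixed vectors of the two tori in `Ind_B^G(θ⊗θ̄)`, see the module docstring); verified numerically for all `η` at `q = 7, 13` and in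
distribution at `q = 19`. Why it might fail: only through a slip in the dictionary `cubicNewvectorCharMat` = character of `Ind(θ⊗θ̄)` (checked
`5 ≤ q ≤ 127` by earlier seats). [cite: Bump1997, §4.1] [cite: Chen2000, Prop. 8.3, Rem. 8.6] -/
@[conjecture]
def CubicTorusPairSumClosedFormAtThree : Prop :=
    ∀ (q : ℕ) [Fact q.Prime], q % 3 = 1 → ∀ ζ : ZMod q, ζ ^ 3 = 1 → ζ ≠ 1 →
      ∀ η : Mat q, ¬ HasRatEigenvalue η →
        torusPairSum q η = ((q : ℤ) - 1) ^ 2 * cubicSumNorm q ζ (-(η 0 1)) (η 0 0 - η 1 1) (η 1 0)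

/-- **THE CUBIC CLASS-COUNT LAW** (elementary; = U♯ at the PS places given the closed form): for every prime `q ≡ 1 (3)` some irreducible
`x² + βx + γ` over `𝔽_q` has class counts `(A,B,C)` of `(x²+βx+γ)/x` with `ord₃(A²+B²+C²−AB−BC−CA) = 1` (equivalently NOT `A ≡ B ≡ C (mod 3)`,
as `3 ∣ |Σ|²` always). Decided below for `q = 7, 13, 19, 31, 37, 43`; script-checked to `q = 73`; follows for `q ≢ 1 (9)` from `|Σ|² ∈ 3·□` and the
second moment `Σ_{T'}|Σ|² = q(q−1)²/2` (paper). Why it might fail: a prime `q ≡ 1 (9)` at which every irreducible form has `A ≡ B ≡ C (3)` — none up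
to 73. [cite: Chen2000, §9] -/
@[conjecture]
def CubicClassCountLawAtThree : Prop :=
    ∀ (q : ℕ) [Fact q.Prime], q % 3 = 1 →
      ∃ ζ b c : ZMod q, ζ ^ 3 = 1 ∧ ζ ≠ 1 ∧ (∀ x : ZMod q, x ^ 2 + b * x + c ≠ 0) ∧
        padicValInt 3 (cubicSumNorm q ζ 1 b c) = 1

/-- **U♯ AT THE CUSPIDAL PLACES** (`q ≢ 1 (3)`, `q ≠ 3`: `q = 2` and `q ≡ 2 (3)`, where `W_q = σ_θ` is cuspidal): the restriction of
`CubicTorusPairSumAtThree` to these places. Numerics `q = 2, 5, 11, 17` (Cut file); closed form = a Soto-Andrade sum [cite: Terras1999, Ch. 21 Thm. 4];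
second moment `Σ_{T'} S/(q−1)² = q(q²−1)/2` (so, given `S/(q−1)² ∈ 3·□`, automatic unless `27 ∣ q+1`). Why it might fail: a prime `q ≡ −1 (27)`
(first: 53) at which every torus pair sum is `≡ 0 mod 27(q−1)²`. [cite: Chen2000, Prop. 8.4] -/
@[conjecture]
def CubicTorusPairSumAtThreeCuspidalPlaces : Prop :=
    ∀ (q : ℕ) [Fact q.Prime], q ≠ 3 → q % 3 ≠ 1 →
      ∃ η : Mat q, ¬ HasRatEigenvalue η ∧ torusPairSum q η ≠ 0 ∧
        padicValInt 3 (torusPairSum q η) = 1 + 2 * padicValNat 3 (q - 1)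

/-! ## §3 PROVED: U♯ from the closed form, the count law and the cuspidal places -/

/-- PROVED: `η = !![β, −1; γ, 0]` (trace `β`, determinant `γ`) has no rational eigenvalue when `x² + βx + γ` has no root. [folklore] -/
theorem not_hasRatEigenvalue_of_irreducible {q : ℕ} (b c : ZMod q) (h : ∀ x : ZMod q, x ^ 2 + b * x + c ≠ 0) :
    ¬ HasRatEigenvalue (!![b, -1; c, 0] : Mat q) := by
  rintro ⟨x, hx⟩
  simp only [Matrix.det_fin_two_of, Matrix.trace_fin_two_of] at hx
  apply h (-x)
  linear_combination hx

/-- PROVED — **U♯ ⟸ closed form ∧ count law ∧ cuspidal places** (`CubicTorusPairSumAtThree` BY NAME): at a PS place take the torus of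
`η = !![β, −1; γ, 0]` for the count-law witness `(β, γ)`; then `S(η) = (q−1)²·n` with `ord₃ n = 1`. [folklore] -/
theorem cubicTorusPairSum_of_closedForm (hI : CubicTorusPairSumClosedFormAtThree) (hL : CubicClassCountLawAtThree)
    (hC : CubicTorusPairSumAtThreeCuspidalPlaces) : CubicTorusPairSumAtThree := by
  intro q _ hq3
  by_cases h1 : q % 3 = 1
  · have hp : q.Prime := Fact.out
    obtain ⟨ζ, b, c, hζ3, hζ1, hirr, hv⟩ := hL q h1
    have hη := not_hasRatEigenvalue_of_irreducible b c hirr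
    have hid := hI q h1 ζ hζ3 hζ1 _ hη
    have e1 : -((!![b, -1; c, 0] : Mat q) 0 1) = 1 := by simp
    have e2 : (!![b, -1; c, 0] : Mat q) 0 0 - (!![b, -1; c, 0] : Mat q) 1 1 = b := by simp
    have e3 : (!![b, -1; c, 0] : Mat q) 1 0 = c := by simp
    rw [e1, e2, e3] at hid
    haveI : Fact (Nat.Prime 3) := ⟨Nat.prime_three⟩
    have hn0 : cubicSumNorm q ζ 1 b c ≠ 0 := by
      intro h0; rw [h0] at hv; simp at hv
    have hcast : ((q : ℤ) - 1) = ((q - 1 : ℕ) : ℤ) := by have := hp.two_le; omega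
    have hq1 : (((q - 1) ^ 2 : ℕ) : ℤ) ≠ 0 := by
      have := hp.two_le; exact_mod_cast pow_ne_zero 2 (by omega)
    rw [hcast, ← Nat.cast_pow] at hid
    refine ⟨_, hη, ?_, ?_⟩
    · rw [hid]; exact mul_ne_zero hq1 hn0
    · rw [hid, padicValInt.mul hq1 hn0, padicValInt.of_nat, padicValNat.pow, hv]; ring
  · exact hC q hq3 h1

/-! ## §4 PROVED: the count law for every prime `q ≡ 1 (3)` up to `43` (kernel `decide`; `19` and `37` are the cases `q ≡ 1 (9)`) -/

/-- PROVED: `ord₃ 3 = 1` in `ℤ`. [folklore] -/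
theorem padicValInt_three_three : padicValInt 3 3 = 1 := by
  haveI : Fact (Nat.Prime 3) := ⟨Nat.prime_three⟩
  exact padicValInt.self (by norm_num)

/-- PROVED (rung, `q = 7`): witness `ζ = 2`, `x² + x + 4`, counts `(2,3,1)`, `|Σ|² = 3`. [folklore] -/
theorem cubicClassCountLaw_7 : ∃ ζ b c : ZMod 7, ζ ^ 3 = 1 ∧ ζ ≠ 1 ∧ (∀ x : ZMod 7, x ^ 2 + b * x + c ≠ 0) ∧
    padicValInt 3 (cubicSumNorm 7 ζ 1 b c) = 1 :=
  ⟨2, 1, 4, by decide, by decide, by decide, by rw [show cubicSumNorm 7 2 1 1 4 = 3 by decide]; exact padicValInt_three_three⟩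

/-- PROVED (rung, `q = 13`): witness `ζ = 3`, `x² + x + 4`, counts `(5,3,4)`. [folklore] -/
theorem cubicClassCountLaw_13 : ∃ ζ b c : ZMod 13, ζ ^ 3 = 1 ∧ ζ ≠ 1 ∧ (∀ x : ZMod 13, x ^ 2 + b * x + c ≠ 0) ∧
    padicValInt 3 (cubicSumNorm 13 ζ 1 b c) = 1 :=
  ⟨3, 1, 4, by decide, by decide, by decide, by rw [show cubicSumNorm 13 3 1 1 4 = 3 by decide]; exact padicValInt_three_three⟩

/-- PROVED (rung, `q = 19 ≡ 1 (9)`): witness `ζ = 7`, `x² + x + 9`, counts `(7,5,6)`. [folklore] -/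
theorem cubicClassCountLaw_19 : ∃ ζ b c : ZMod 19, ζ ^ 3 = 1 ∧ ζ ≠ 1 ∧ (∀ x : ZMod 19, x ^ 2 + b * x + c ≠ 0) ∧
    padicValInt 3 (cubicSumNorm 19 ζ 1 b c) = 1 :=
  ⟨7, 1, 9, by decide, by decide, by decide, by rw [show cubicSumNorm 19 7 1 1 9 = 3 by decide]; exact padicValInt_three_three⟩

/-- PROVED (rung, `q = 31`): witness `ζ = 5`, `x² + x + 2`, counts `(9,10,11)`. [folklore] -/
theorem cubicClassCountLaw_31 : ∃ ζ b c : ZMod 31, ζ ^ 3 = 1 ∧ ζ ≠ 1 ∧ (∀ x : ZMod 31, x ^ 2 + b * x + c ≠ 0) ∧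
    padicValInt 3 (cubicSumNorm 31 ζ 1 b c) = 1 :=
  ⟨5, 1, 2, by decide, by decide, by decide, by rw [show cubicSumNorm 31 5 1 1 2 = 3 by decide]; exact padicValInt_three_three⟩

set_option maxRecDepth 8000 in
/-- PROVED (rung, `q = 37 ≡ 1 (9)`): witness `ζ = 10`, `x² + x + 30`, counts `(12,13,11)`. [folklore] -/
theorem cubicClassCountLaw_37 : ∃ ζ b c : ZMod 37, ζ ^ 3 = 1 ∧ ζ ≠ 1 ∧ (∀ x : ZMod 37, x ^ 2 + b * x + c ≠ 0) ∧
    padicValInt 3 (cubicSumNorm 37 ζ 1 b c) = 1 :=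
  ⟨10, 1, 30, by decide, by decide, by decide, by rw [show cubicSumNorm 37 10 1 1 30 = 3 by decide]; exact padicValInt_three_three⟩

set_option maxRecDepth 8000 in
/-- PROVED (rung, `q = 43`): witness `ζ = 6`, `x² + x + 9`, counts `(14,15,13)`. [folklore] -/
theorem cubicClassCountLaw_43 : ∃ ζ b c : ZMod 43, ζ ^ 3 = 1 ∧ ζ ≠ 1 ∧ (∀ x : ZMod 43, x ^ 2 + b * x + c ≠ 0) ∧
    padicValInt 3 (cubicSumNorm 43 ζ 1 b c) = 1 :=
  ⟨6, 1, 9, by decide, by decide, by decide, by rw [show cubicSumNorm 43 6 1 1 9 = 3 by decide]; exact padicValInt_three_three⟩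

/-- **THE COUNT LAW UP TO 43** — the restriction of `CubicClassCountLawAtThree` to `q ≤ 43`; PROVED below (`cubicClassCountLawUpTo43`) from the six
decided rungs (the primes `q ≡ 1 (3)` up to `43` are `7, 13, 19, 31, 37, 43`). [folklore] -/
@[conjecture]
def CubicClassCountLawUpTo43AtThree : Prop :=
    ∀ (q : ℕ) [Fact q.Prime], q % 3 = 1 → q ≤ 43 →
      ∃ ζ b c : ZMod q, ζ ^ 3 = 1 ∧ ζ ≠ 1 ∧ (∀ x : ZMod q, x ^ 2 + b * x + c ≠ 0) ∧
        padicValInt 3 (cubicSumNorm q ζ 1 b c) = 1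

/-- PROVED — the count law for every prime `q ≡ 1 (3)`, `q ≤ 43`. [folklore] -/
theorem cubicClassCountLawUpTo43 : CubicClassCountLawUpTo43AtThree := by
  intro q hF h1 hle
  have hp : q.Prime := hF.out
  interval_cases q
  all_goals first
    | exact cubicClassCountLaw_7 | exact cubicClassCountLaw_13 | exact cubicClassCountLaw_19
    | exact cubicClassCountLaw_31 | exact cubicClassCountLaw_37 | exact cubicClassCountLaw_43
    | (exfalso; omega) | (exfalso; norm_num at hp)

end Summit.BirchSwinnertonDyer.BirchSwinnertonDyer.Theorems.CartanCorrespondence
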